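import Mathlib
import Summits.Ventures.PercRepro2.ZMeanProof
import Summits.Ventures.PercRepro2.PendantRoot
import Summits.Ventures.PercRepro2.PocketTransport
import Summits.Ventures.PercRepro2.StarGlue
import Summits.Ventures.PercRepro2.StarOProb
import Summits.Ventures.PercRepro2.StarHStar

/-!
# The ten cells of the `(o, b)`-partition law under `Q₁` (blind cell PercRepro2, night-1 g11;
NIGHT1-G11.md §5)

Under `Q₁ = {a₁ ↮ a₂}` the pair `(o, b)` sits in one of ten cells, each a FULL pattern of the five
atoms `a₁ ↔ o, a₂ ↔ o, a₁ ↔ b, a₂ ↔ b, o ↔ b` (the side of each mark: `L` = with `a₁`, `H` = with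
`a₂`, `N` = with neither; the `(N, N)` cell split by `o ↔ b`).  `cell_partition`: under `Q₁` exactly
the ten consistent patterns occur (transitivity kills the other twenty-two); `cLN_eq` etc. identify
the cells with the natural events `Q ∩ {o ∈ C₁} ∩ {b ∉ U}`, …; every star-closed reading of a hub
mass is a union of cells.
-/

namespace Summit.Ventures.PercRepro2

open StarGlue PendantRoot

namespace StarH

section Cells

variable {V : Type*} {E : Type*}

variable (ends : E → Sym2 V) (a₁ a₂ o b : V)

/-- `Q₁ = {a₁ ↮ a₂}`. -/
abbrev Q₀ : Set (Config E) := avoidAll ends a₂ {a₁}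

/-- The cell `LL` (`o ∈ C₁, b ∈ C₁`), as the full pattern of the five atoms. -/
def cLL : Set (Config E) :=
  Q₀ ends a₁ a₂ ∩ connEvent ends a₁ o ∩ (connEvent ends a₂ o)ᶜ ∩ connEvent ends a₁ b ∩ (connEvent ends a₂ b)ᶜ ∩ connEvent ends o b

/-- The cell `LH` (`o ∈ C₁, b ∈ C₂`), as the full pattern of the five atoms. -/
def cLH : Set (Config E) :=
  Q₀ ends a₁ a₂ ∩ connEvent ends a₁ o ∩ (connEvent ends a₂ o)ᶜ ∩ (connEvent ends a₁ b)ᶜ ∩ connEvent ends a₂ b ∩ (connEvent ends o b)ᶜ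

/-- The cell `LN` (`o ∈ C₁, b ∉ U`), as the full pattern of the five atoms. -/
def cLN : Set (Config E) :=
  Q₀ ends a₁ a₂ ∩ connEvent ends a₁ o ∩ (connEvent ends a₂ o)ᶜ ∩ (connEvent ends a₁ b)ᶜ ∩ (connEvent ends a₂ b)ᶜ ∩ (connEvent ends o b)ᶜ

/-- The cell `HL` (`o ∈ C₂, b ∈ C₁`), as the full pattern of the five atoms. -/
def cHL : Set (Config E) :=
  Q₀ ends a₁ a₂ ∩ (connEvent ends a₁ o)ᶜ ∩ connEvent ends a₂ o ∩ connEvent ends a₁ b ∩ (connEvent ends a₂ b)ᶜ ∩ (connEvent ends o b)ᶜ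

/-- The cell `HH` (`o ∈ C₂, b ∈ C₂`), as the full pattern of the five atoms. -/
def cHH : Set (Config E) :=
  Q₀ ends a₁ a₂ ∩ (connEvent ends a₁ o)ᶜ ∩ connEvent ends a₂ o ∩ (connEvent ends a₁ b)ᶜ ∩ connEvent ends a₂ b ∩ connEvent ends o b

/-- The cell `HN` (`o ∈ C₂, b ∉ U`), as the full pattern of the five atoms. -/
def cHN : Set (Config E) :=
  Q₀ ends a₁ a₂ ∩ (connEvent ends a₁ o)ᶜ ∩ connEvent ends a₂ o ∩ (connEvent ends a₁ b)ᶜ ∩ (connEvent ends a₂ b)ᶜ ∩ (connEvent ends o b)ᶜ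

/-- The cell `NL` (`o ∉ U, b ∈ C₁`), as the full pattern of the five atoms. -/
def cNL : Set (Config E) :=
  Q₀ ends a₁ a₂ ∩ (connEvent ends a₁ o)ᶜ ∩ (connEvent ends a₂ o)ᶜ ∩ connEvent ends a₁ b ∩ (connEvent ends a₂ b)ᶜ ∩ (connEvent ends o b)ᶜ

/-- The cell `NH` (`o ∉ U, b ∈ C₂`), as the full pattern of the five atoms. -/
def cNH : Set (Config E) :=
  Q₀ ends a₁ a₂ ∩ (connEvent ends a₁ o)ᶜ ∩ (connEvent ends a₂ o)ᶜ ∩ (connEvent ends a₁ b)ᶜ ∩ connEvent ends a₂ b ∩ (connEvent ends o b)ᶜ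

/-- The cell `NNt` (`o ∉ U, b ∉ U, o ↔ b`), as the full pattern of the five atoms. -/
def cNNt : Set (Config E) :=
  Q₀ ends a₁ a₂ ∩ (connEvent ends a₁ o)ᶜ ∩ (connEvent ends a₂ o)ᶜ ∩ (connEvent ends a₁ b)ᶜ ∩ (connEvent ends a₂ b)ᶜ ∩ connEvent ends o b

/-- The cell `NNs` (`o ∉ U, b ∉ U, o ↮ b`), as the full pattern of the five atoms. -/
def cNNs : Set (Config E) :=
  Q₀ ends a₁ a₂ ∩ (connEvent ends a₁ o)ᶜ ∩ (connEvent ends a₂ o)ᶜ ∩ (connEvent ends a₁ b)ᶜ ∩ (connEvent ends a₂ b)ᶜ ∩ (connEvent ends o b)ᶜ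

/-- Membership in `Q₀`. -/
lemma mem_Q₀ {ω : Config E} : ω ∈ Q₀ ends a₁ a₂ ↔ ¬ Conn ends ω a₁ a₂ := by
  rw [Q₀, avoidAll_eq_compl]; rfl

/-- Membership in `PD`. -/
lemma mem_PD₄ (a₃ : V) {ω : Config E} :
    ω ∈ PDEvent ends a₁ a₂ a₃ ↔ ¬ Conn ends ω a₁ a₂ ∧ ¬ Conn ends ω a₃ a₁ ∧ ¬ Conn ends ω a₃ a₂ := by
  simp only [PDEvent, Dtilde, UnionCluster.inU, Set.mem_inter_iff, Set.mem_compl_iff, mem_connEvent,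
    Set.mem_union, not_or]

/-- Membership in `T`. -/
lemma mem_T₄ (a₃ : V) {ω : Config E} :
    ω ∈ TEvent ends a₁ a₂ a₃ ↔ ¬ Conn ends ω a₂ a₁ ∧ Conn ends ω a₂ a₃ := by
  simp only [TEvent, Set.mem_inter_iff, Set.mem_compl_iff, mem_connEvent]

/-- **The ten cells partition `Q₁`**: a configuration with `a₁ ↮ a₂` lies in exactly one of the ten
consistent patterns of the five atoms. -/
theorem cell_partition {ω : Config E} :
    ω ∈ Q₀ ends a₁ a₂ ↔
      ω ∈ cLL ends a₁ a₂ o b ∨ ω ∈ cLH ends a₁ a₂ o b ∨ ω ∈ cLN ends a₁ a₂ o b ∨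
      ω ∈ cHL ends a₁ a₂ o b ∨ ω ∈ cHH ends a₁ a₂ o b ∨ ω ∈ cHN ends a₁ a₂ o b ∨
      ω ∈ cNL ends a₁ a₂ o b ∨ ω ∈ cNH ends a₁ a₂ o b ∨ ω ∈ cNNt ends a₁ a₂ o b ∨
      ω ∈ cNNs ends a₁ a₂ o b := by
  have t1 : Conn ends ω a₁ o → Conn ends ω a₂ o → Conn ends ω a₁ a₂ := fun h h' => conn_trans h (conn_symm h')
  have t4 : Conn ends ω a₁ b → Conn ends ω a₂ b → Conn ends ω a₁ a₂ := fun h h' => conn_trans h (conn_symm h')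
  have t7 : Conn ends ω a₁ o → Conn ends ω a₁ b → Conn ends ω o b := fun h h' => conn_trans (conn_symm h) h'
  have t8 : Conn ends ω a₁ o → Conn ends ω o b → Conn ends ω a₁ b := fun h h' => conn_trans h h'
  have t9 : Conn ends ω a₁ b → Conn ends ω o b → Conn ends ω a₁ o := fun h h' => conn_trans h (conn_symm h')
  have t10 : Conn ends ω a₂ o → Conn ends ω a₂ b → Conn ends ω o b := fun h h' => conn_trans (conn_symm h) h'
  have t11 : Conn ends ω a₂ o → Conn ends ω o b → Conn ends ω a₂ b := fun h h' => conn_trans h h'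
  have t12 : Conn ends ω a₂ b → Conn ends ω o b → Conn ends ω a₂ o := fun h h' => conn_trans h (conn_symm h')
  simp only [cLL, cLH, cLN, cHL, cHH, cHN, cNL, cNH, cNNt, cNNs, Set.mem_inter_iff, Set.mem_compl_iff,
    mem_connEvent, mem_Q₀]
  by_cases h1o : Conn ends ω a₁ o <;> by_cases h2o : Conn ends ω a₂ o <;>
    by_cases h1b : Conn ends ω a₁ b <;> by_cases h2b : Conn ends ω a₂ b <;>
    by_cases hob : Conn ends ω o b <;> simp_all

/-- `Q ∩ {o ∈ C₁} ∩ {b ∈ C₂}` is the cell `LH`. -/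
lemma cLH_eq :
    avoidAll ends a₂ {a₁} ∩ connEvent ends a₁ o ∩ connEvent ends a₂ b = cLH ends a₁ a₂ o b := by
  ext ω
  have t1 : Conn ends ω a₁ o → Conn ends ω a₂ o → Conn ends ω a₁ a₂ := fun h h' => conn_trans h (conn_symm h')
  have t4 : Conn ends ω a₁ b → Conn ends ω a₂ b → Conn ends ω a₁ a₂ := fun h h' => conn_trans h (conn_symm h')
  have t8 : Conn ends ω a₁ o → Conn ends ω o b → Conn ends ω a₁ b := fun h h' => conn_trans h h'
  simp only [cLH, Set.mem_inter_iff, Set.mem_compl_iff, mem_connEvent, avoidAll_eq_compl]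
  tauto

/-- `Q ∩ {o ∈ C₂} ∩ {b ∈ C₁}` is the cell `HL`. -/
lemma cHL_eq :
    avoidAll ends a₂ {a₁} ∩ connEvent ends a₂ o ∩ connEvent ends a₁ b = cHL ends a₁ a₂ o b := by
  ext ω
  have t1 : Conn ends ω a₁ o → Conn ends ω a₂ o → Conn ends ω a₁ a₂ := fun h h' => conn_trans h (conn_symm h')
  have t4 : Conn ends ω a₁ b → Conn ends ω a₂ b → Conn ends ω a₁ a₂ := fun h h' => conn_trans h (conn_symm h')
  have t11 : Conn ends ω a₂ o → Conn ends ω o b → Conn ends ω a₂ b := fun h h' => conn_trans h h'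
  simp only [cHL, Set.mem_inter_iff, Set.mem_compl_iff, mem_connEvent, avoidAll_eq_compl]
  tauto

end Cells

end StarH

end Summit.Ventures.PercRepro2
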